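import Literature.Barriers.Parity.SmallScalePatternsEndgame
import Literature.NumberTheory.LFunctions.PrimeNumberTheoremProgressions
import HarnessLib

/-!
# Small-scale irregularity of linear patterns of primes: systems with a dual frame (tools)

Proof companion of `Literature/Barriers/Parity/SmallScalePatterns.lean` (Pandey–Woo 2024,
Theorem 5 = the named fact `SmallScalePatternIrregularity`). Everything here is PROVED.

The companions `SmallScalePatterns{SingleForm,Walk,Endgame,Proofs}.lean` prove the case `t = 1` of
the fact. This file and `SmallScalePatternsFrameProofs.lean` prove it for every in-scope system
`Ψ = (ψ₁, …, ψ_t)` (any `t, d ≥ 1`) that admits a DUAL FRAME: vectors `v₁, …, v_t ∈ ℤ^d` with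
`ψᵢ(v_l) = δ_{il}` (`IsDualFrame`). Equivalently `Ψ : ℤ^d → ℤ^t` is surjective; these are exactly
the systems of Green–Tao complexity `0` (linearly independent forms) without lattice obstruction,
and for them every local factor is `β_p = 1` (`localFactor_eq_one_of_frame`). Examples:
`(x, x + y)`, `(x, y, x + y + z)`, any single primitive form (a Bézout vector is a frame).

The device (generalising the walk of `SmallScalePatternsWalk.lean` to several forms): for a base
point `b` with `ψᵢ(b) = mᵢ + 1` and a multi-index `k = (k₁, …, k_t)`, the corner
`z_k = b + ∑_l k_l v_l` has `ψᵢ(z_k + u) = mᵢ + 1 + kᵢ + ψᵢ(u)`, so that summing the prime-pattern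
count of the box `z_k + {0, …, H}^d` over `k ∈ ∏ᵢ [0, hᵢ)` gives
`∑_u ∏ᵢ (π(mᵢ + ψᵢ(u) + hᵢ) − π(mᵢ + ψᵢ(u)))` — a PRODUCT of shifted windows
(`walk_sum_eq`), whence `(H+1)^d ∏ᵢ (Rᵢ − σᵢH) ≤ ∑_k cnt(z_k) ≤ (H+1)^d ∏ᵢ (Rᵢ + σᵢH)` with
`Rᵢ = π(mᵢ + hᵢ) − π(mᵢ)`, `σᵢ = ∑ⱼ ψᵢ(eⱼ)` (`le_walk_sum`, `walk_sum_le`) and the pigeonhole over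
`k`. In the proof of the theorem ONE window is a row of Maier's matrix and the other `t − 1` are
long windows counted by the prime number theorem (`eventually_theta_window`, from the tree's
`Literature.NumberTheory.LFunctions.chebyshevTheta_sub_self_isLittleO`).
[cite: PandeyWoo2024, Theorem 5 and §2.4]

## References

* M. Pandey, K. Woo, *Small scale distribution of linear patterns of primes*, J. London Math.
  Soc. 110 (2024) e13001, arXiv:2304.14267: Theorem 5, §2.4.
* B. Green, T. Tao, *Linear equations in primes*, Ann. of Math. 171 (2010), (1.6) (`β_p`) and
  the discussion of complexity `0` after Def. 1.5.
-/

noncomputable section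

open Filter Finset Topology

namespace Literature.Barriers.Parity

open Literature.NumberTheory.Sieve Literature.Barriers.Parity.Maier SingleForm

namespace Frame

variable {d t : ℕ}

/-! ## Dual frames -/

/-- `v = (v₁, …, v_t)` is a *dual frame* for the system `Ψ = (ψ₁, …, ψ_t)` of forms on `ℤ^d`:
`ψᵢ(v_l) = 1` if `i = l` and `0` otherwise. For linear forms (`ψᵢ(0) = 0`) such a frame exists iff
`Ψ : ℤ^d → ℤ^t` is surjective. [cite: GreenTao2010, Def. 1.5 (complexity `0`)] -/
def IsDualFrame (Ψ : Fin t → AffLinForm d) (v : Fin t → Fin d → ℤ) : Prop :=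
  ∀ i l, (Ψ i).eval (v l) = if i = l then 1 else 0

/-- A linear form on an integer combination of vectors: `ψ(∑_l c_l v_l) = ∑_l c_l ψ(v_l)`.
[folklore] -/
theorem eval_sum_mul (ψ : AffLinForm d) (h0 : ψ.const = 0) {ι : Type*} (s : Finset ι)
    (c : ι → ℤ) (v : ι → Fin d → ℤ) :
    ψ.eval (fun j => ∑ l ∈ s, c l * v l j) = ∑ l ∈ s, c l * ψ.eval (v l) := by
  simp only [eval_eq_sum ψ h0]
  simp_rw [mul_sum]
  rw [sum_comm]
  refine sum_congr rfl fun l _ => sum_congr rfl fun j _ => by ring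

/-- Along a dual frame the forms read off the coefficients:
`ψᵢ(b + ∑_l k_l v_l) = ψᵢ(b) + kᵢ`. [folklore] -/
theorem eval_corner (Ψ : Fin t → AffLinForm d) (h0 : ∀ i, (Ψ i).const = 0)
    {v : Fin t → Fin d → ℤ} (hv : IsDualFrame Ψ v) (b : Fin d → ℤ) (k : Fin t → ℤ) (i : Fin t) :
    (Ψ i).eval (b + fun j => ∑ l, k l * v l j) = (Ψ i).eval b + k i := by
  rw [eval_add _ (h0 i), eval_sum_mul _ (h0 i)]
  congr 1
  rw [sum_eq_single i (fun l _ hl => by rw [hv i l, if_neg (Ne.symm hl), mul_zero])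
    (fun h => absurd (mem_univ i) h), hv i i, if_pos rfl, mul_one]

/-! ## The multi-index walk: double counting -/

/-- Coordinate-wise conditions cut a product set down to a product set. [folklore] -/
theorem filter_piFinset_forall {ι : Type*} [Fintype ι] [DecidableEq ι] {α : ι → Type*}
    (s : ∀ i, Finset (α i)) (p : ∀ i, α i → Prop) [∀ i, DecidablePred (p i)] :
    {f ∈ Fintype.piFinset s | ∀ i, p i (f i)} = Fintype.piFinset fun i => (s i).filter (p i) := by
  ext f
  simp only [mem_filter, Fintype.mem_piFinset]
  exact ⟨fun h i => ⟨h.1 i, h.2 i⟩, fun h => ⟨fun i => (h i).1, fun i => (h i).2⟩⟩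

/-- **Double counting along the walk.** For linear forms `ψᵢ` with non-negative coefficients, a
dual frame `v`, a base point `b` with `ψᵢ(b) = mᵢ + 1`, widths `hᵢ` and a side `H`: with corners
`z_k = b + ∑_l k_l v_l` and `Wᵢ(u) = ψᵢ(u)`,
`∑_{k ∈ ∏[0,hᵢ)} #{u ∈ {0..H}^d : all ψᵢ(z_k + u) prime} = ∑_u ∏ᵢ #{κ < hᵢ : mᵢ + Wᵢ(u) + κ + 1 prime}`.
[cite: PandeyWoo2024, §2.4 (double counting)] -/
theorem walk_sum_eq (Ψ : Fin t → AffLinForm d) (h0 : ∀ i, (Ψ i).const = 0)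
    (hc : ∀ i j, 0 ≤ (Ψ i).coeff j) {v : Fin t → Fin d → ℤ} (hv : IsDualFrame Ψ v)
    (b : Fin d → ℤ) (m : Fin t → ℕ) (hb : ∀ i, (Ψ i).eval b = m i + 1) (hw : Fin t → ℕ) (Hn : ℕ) :
    ∑ k ∈ Fintype.piFinset (fun i => range (hw i)),
        #{u ∈ Fintype.piFinset (fun _ : Fin d => range (Hn + 1)) |
          ∀ i, ((Ψ i).eval ((fun j => b j + ∑ l, (k l : ℤ) * v l j) + fun j => (u j : ℤ))).toNat.Prime} =
      ∑ u ∈ Fintype.piFinset (fun _ : Fin d => range (Hn + 1)),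
        ∏ i, #{κ ∈ range (hw i) |
          (m i + ((Ψ i).eval fun j => (u j : ℤ)).toNat + (κ + 1)).Prime} := by
  set U := Fintype.piFinset (fun _ : Fin d => range (Hn + 1)) with hU
  set K := Fintype.piFinset (fun i => range (hw i)) with hK
  set W : Fin t → (Fin d → ℕ) → ℕ := fun i u => ((Ψ i).eval fun j => (u j : ℤ)).toNat with hWdef
  have hWint : ∀ i (u : Fin d → ℕ), (W i u : ℤ) = (Ψ i).eval fun j => (u j : ℤ) := fun i u =>
    Int.toNat_of_nonneg (eval_nonneg _ (h0 i) (hc i) fun j => by positivity)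
  -- the value at `z_k + u`
  have hval : ∀ (k : Fin t → ℕ) (u : Fin d → ℕ) i,
      ((Ψ i).eval ((fun j => b j + ∑ l, (k l : ℤ) * v l j) + fun j => (u j : ℤ))).toNat =
        m i + W i u + (k i + 1) := by
    intro k u i
    have h1 : (Ψ i).eval ((fun j => b j + ∑ l, (k l : ℤ) * v l j) + fun j => (u j : ℤ)) =
        ((m i + W i u + (k i + 1) : ℕ) : ℤ) := by
      rw [eval_add _ (h0 i)]
      have := eval_corner Ψ h0 hv b (fun l => (k l : ℤ)) i
      rw [show (b + fun j => ∑ l, (k l : ℤ) * v l j) = fun j => b j + ∑ l, (k l : ℤ) * v l j from rfl]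
        at this
      rw [this, hb i]
      push_cast
      rw [hWint]
      ring
    rw [h1, Int.toNat_natCast]
  have hcnt : ∀ k ∈ K, #{u ∈ U | ∀ i, ((Ψ i).eval ((fun j => b j + ∑ l, (k l : ℤ) * v l j) +
      fun j => (u j : ℤ))).toNat.Prime} = #{u ∈ U | ∀ i, (m i + W i u + (k i + 1)).Prime} := by
    intro k _
    refine congrArg Finset.card (filter_congr fun u _ => ?_)
    simp only [hval]
  rw [sum_congr rfl hcnt]
  -- swap the sums
  have hswap : ∑ k ∈ K, #{u ∈ U | ∀ i, (m i + W i u + (k i + 1)).Prime} =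
      ∑ u ∈ U, #{k ∈ K | ∀ i, (m i + W i u + (k i + 1)).Prime} := by
    simp only [card_filter]
    exact sum_comm
  rw [hswap]
  refine sum_congr rfl fun u _ => ?_
  rw [hK, ← Fintype.card_piFinset]
  congr 1
  convert filter_piFinset_forall (fun i => range (hw i)) (fun i κ => (m i + W i u + (κ + 1)).Prime)
    using 3

/-- **Upper bound along the walk**: with `Rᵢ = π(mᵢ + hᵢ) − π(mᵢ)` and `σᵢ = ∑ⱼ ψᵢ(eⱼ)`,
`∑_k cnt(z_k) ≤ (H+1)^d ∏ᵢ (Rᵢ + σᵢ H)` (a window shifted by `ψᵢ(u) ≤ σᵢH` gains at most `σᵢH`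
primes). [cite: PandeyWoo2024, §2.4] -/
theorem walk_sum_le (Ψ : Fin t → AffLinForm d) (h0 : ∀ i, (Ψ i).const = 0)
    (hc : ∀ i j, 0 ≤ (Ψ i).coeff j) {v : Fin t → Fin d → ℤ} (hv : IsDualFrame Ψ v)
    (b : Fin d → ℤ) (m : Fin t → ℕ) (hb : ∀ i, (Ψ i).eval b = m i + 1) (hw : Fin t → ℕ) (Hn : ℕ) :
    ∑ k ∈ Fintype.piFinset (fun i => range (hw i)),
        #{u ∈ Fintype.piFinset (fun _ : Fin d => range (Hn + 1)) |
          ∀ i, ((Ψ i).eval ((fun j => b j + ∑ l, (k l : ℤ) * v l j) + fun j => (u j : ℤ))).toNat.Prime} ≤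
      #(Fintype.piFinset (fun _ : Fin d => range (Hn + 1))) *
        ∏ i, (#{κ ∈ range (hw i) | (m i + (κ + 1)).Prime} + (∑ j, (Ψ i).coeff j).toNat * Hn) := by
  classical
  rw [walk_sum_eq Ψ h0 hc hv b m hb hw Hn]
  set U := Fintype.piFinset (fun _ : Fin d => range (Hn + 1)) with hU
  have h1 : ∀ u ∈ U, ∏ i, #{κ ∈ range (hw i) |
      (m i + ((Ψ i).eval fun j => (u j : ℤ)).toNat + (κ + 1)).Prime} ≤
      ∏ i, (#{κ ∈ range (hw i) | (m i + (κ + 1)).Prime} + (∑ j, (Ψ i).coeff j).toNat * Hn) := by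
    intro u hu
    have hu' : ∀ j, u j ≤ Hn := fun j => by
      have := Fintype.mem_piFinset.1 hu j
      rw [mem_range] at this
      omega
    refine prod_le_prod (fun i _ => Nat.zero_le _) fun i _ => ?_
    have hWle : ((Ψ i).eval fun j => (u j : ℤ)).toNat ≤ (∑ j, (Ψ i).coeff j).toNat * Hn := by
      have hc1 : 0 ≤ ∑ j, (Ψ i).coeff j := sum_nonneg fun j _ => hc i j
      have e1 : (Ψ i).eval (fun j => (u j : ℤ)) ≤ (∑ j, (Ψ i).coeff j) * Hn :=
        eval_le _ (h0 i) (hc i) (B := Hn) fun j => by exact_mod_cast hu' j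
      have e2 : ((((Ψ i).eval fun j => (u j : ℤ)).toNat : ℕ) : ℤ) ≤ ((∑ j, (Ψ i).coeff j).toNat : ℕ) * Hn := by
        rw [Int.toNat_of_nonneg (eval_nonneg _ (h0 i) (hc i) fun j => by positivity),
          Int.toNat_of_nonneg hc1]
        exact e1
      exact_mod_cast e2
    have := window_shift_le (hw i) (Nat.le_add_right (m i) ((Ψ i).eval fun j => (u j : ℤ)).toNat)
    rw [Nat.add_sub_cancel_left] at this
    omega
  calc ∑ u ∈ U, ∏ i, #{κ ∈ range (hw i) | (m i + ((Ψ i).eval fun j => (u j : ℤ)).toNat + (κ + 1)).Prime}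
      ≤ ∑ _u ∈ U, ∏ i, (#{κ ∈ range (hw i) | (m i + (κ + 1)).Prime} + (∑ j, (Ψ i).coeff j).toNat * Hn) :=
        sum_le_sum h1
    _ = _ := by rw [sum_const, smul_eq_mul]

/-- **Lower bound along the walk**: `(H+1)^d ∏ᵢ (Rᵢ − σᵢ H) ≤ ∑_k cnt(z_k)` (truncated
subtraction). [cite: PandeyWoo2024, §2.4] -/
theorem le_walk_sum (Ψ : Fin t → AffLinForm d) (h0 : ∀ i, (Ψ i).const = 0)
    (hc : ∀ i j, 0 ≤ (Ψ i).coeff j) {v : Fin t → Fin d → ℤ} (hv : IsDualFrame Ψ v)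
    (b : Fin d → ℤ) (m : Fin t → ℕ) (hb : ∀ i, (Ψ i).eval b = m i + 1) (hw : Fin t → ℕ) (Hn : ℕ) :
    #(Fintype.piFinset (fun _ : Fin d => range (Hn + 1))) *
        ∏ i, (#{κ ∈ range (hw i) | (m i + (κ + 1)).Prime} - (∑ j, (Ψ i).coeff j).toNat * Hn) ≤
      ∑ k ∈ Fintype.piFinset (fun i => range (hw i)),
        #{u ∈ Fintype.piFinset (fun _ : Fin d => range (Hn + 1)) |
          ∀ i, ((Ψ i).eval ((fun j => b j + ∑ l, (k l : ℤ) * v l j) + fun j => (u j : ℤ))).toNat.Prime} := by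
  classical
  rw [walk_sum_eq Ψ h0 hc hv b m hb hw Hn]
  set U := Fintype.piFinset (fun _ : Fin d => range (Hn + 1)) with hU
  have h1 : ∀ u ∈ U,
      ∏ i, (#{κ ∈ range (hw i) | (m i + (κ + 1)).Prime} - (∑ j, (Ψ i).coeff j).toNat * Hn) ≤
      ∏ i, #{κ ∈ range (hw i) | (m i + ((Ψ i).eval fun j => (u j : ℤ)).toNat + (κ + 1)).Prime} := by
    intro u hu
    have hu' : ∀ j, u j ≤ Hn := fun j => by
      have := Fintype.mem_piFinset.1 hu j
      rw [mem_range] at this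
      omega
    refine prod_le_prod (fun i _ => Nat.zero_le _) fun i _ => ?_
    have hWle : ((Ψ i).eval fun j => (u j : ℤ)).toNat ≤ (∑ j, (Ψ i).coeff j).toNat * Hn := by
      have hc1 : 0 ≤ ∑ j, (Ψ i).coeff j := sum_nonneg fun j _ => hc i j
      have e1 : (Ψ i).eval (fun j => (u j : ℤ)) ≤ (∑ j, (Ψ i).coeff j) * Hn :=
        eval_le _ (h0 i) (hc i) (B := Hn) fun j => by exact_mod_cast hu' j
      have e2 : ((((Ψ i).eval fun j => (u j : ℤ)).toNat : ℕ) : ℤ) ≤ ((∑ j, (Ψ i).coeff j).toNat : ℕ) * Hn := by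
        rw [Int.toNat_of_nonneg (eval_nonneg _ (h0 i) (hc i) fun j => by positivity),
          Int.toNat_of_nonneg hc1]
        exact e1
      exact_mod_cast e2
    have := le_window_shift (hw i) (Nat.le_add_right (m i) ((Ψ i).eval fun j => (u j : ℤ)).toNat)
    rw [Nat.add_sub_cancel_left] at this
    omega
  calc #U * ∏ i, (#{κ ∈ range (hw i) | (m i + (κ + 1)).Prime} - (∑ j, (Ψ i).coeff j).toNat * Hn)
      = ∑ _u ∈ U, ∏ i, (#{κ ∈ range (hw i) | (m i + (κ + 1)).Prime} - (∑ j, (Ψ i).coeff j).toNat * Hn) := by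
        rw [sum_const, smul_eq_mul]
    _ ≤ _ := sum_le_sum h1

/-- Pigeonhole over a finite index set: some term is at least the average. [folklore] -/
theorem exists_sum_le_card_mul {ι : Type*} {K : Finset ι} (hK : K.Nonempty) (f : ι → ℕ) :
    ∃ k ∈ K, ∑ i ∈ K, f i ≤ #K * f k := by
  obtain ⟨k, hk, hmax⟩ := exists_max_image K f hK
  exact ⟨k, hk, (sum_le_card_nsmul K f (f k) hmax).trans (by rw [smul_eq_mul])⟩

/-- Pigeonhole over a finite index set: some term is at most the average. [folklore] -/
theorem exists_card_mul_le_sum {ι : Type*} {K : Finset ι} (hK : K.Nonempty) (f : ι → ℕ) :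
    ∃ k ∈ K, #K * f k ≤ ∑ i ∈ K, f i := by
  obtain ⟨k, hk, hmin⟩ := exists_min_image K f hK
  exact ⟨k, hk, (le_of_eq (smul_eq_mul _ _).symm).trans (card_nsmul_le_sum K f (f k) hmin)⟩

/-- The corners of the walk stay near the base point: `|z_k,ⱼ − bⱼ| ≤ ∑_l k_l |v_l,ⱼ|`.
[folklore] -/
theorem abs_corner_sub_le (b : Fin d → ℤ) (v : Fin t → Fin d → ℤ) (k : Fin t → ℕ) (j : Fin d) :
    |(b j + ∑ l, (k l : ℤ) * v l j) - b j| ≤ ∑ l, (k l : ℤ) * |v l j| := by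
  rw [add_sub_cancel_left]
  refine (abs_sum_le_sum_abs _ _).trans (le_of_eq (sum_congr rfl fun l _ => ?_))
  rw [abs_mul, abs_of_nonneg (by positivity)]


/-! ## Local factors of a system with a dual frame -/

/-- **Fibres of a system with a dual frame mod `p`.** For a prime `p`, linear forms `ψᵢ` and a
dual frame, the number of `n ∈ {0,…,p-1}^d` with `p ∤ ψᵢ(n)` for all `i`, times `p^t`, equals
`(p-1)^t p^d`: the homomorphism `n ↦ (ψᵢ(n) mod p)ᵢ`, `(ℤ/p)^d → (ℤ/p)^t`, is onto (the frame
gives preimages), so all its fibres have the cardinality `F` of its kernel, `p^t F = p^d`, and the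
good `n` are the `(p-1)^t F` points over the vectors with no zero coordinate. [folklore] -/
theorem card_good_mul_pow {p : ℕ} (hp : p.Prime) (Ψ : Fin t → AffLinForm d)
    (h0 : ∀ i, (Ψ i).const = 0) {v : Fin t → Fin d → ℤ} (hv : IsDualFrame Ψ v) :
    #{n ∈ Fintype.piFinset (fun _ : Fin d => range p) |
        ∀ i, ¬ (p : ℤ) ∣ (Ψ i).eval fun j => (n j : ℤ)} * p ^ t = (p - 1) ^ t * p ^ d := by
  classical
  haveI := Fact.mk hp
  -- the homomorphism `φ(w) = (∑ⱼ cᵢⱼ wⱼ)ᵢ` on `(ℤ/p)^d`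
  let φ : (Fin d → ZMod p) →+ (Fin t → ZMod p) :=
    { toFun := fun w i => ∑ j, ((Ψ i).coeff j : ZMod p) * w j
      map_zero' := by funext i; simp
      map_add' := fun w w' => by funext i; simp only [Pi.add_apply, mul_add, sum_add_distrib] }
  have hφ : ∀ w i, φ w i = ∑ j, ((Ψ i).coeff j : ZMod p) * w j := fun w i => rfl
  have hcast : ∀ (n : Fin d → ℤ) i,
      (((Ψ i).eval n : ℤ) : ZMod p) = φ (fun j => (n j : ZMod p)) i := by
    intro n i
    rw [eval_eq_sum _ (h0 i), hφ]
    push_cast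
    rfl
  -- preimages from the frame
  let wa : (Fin t → ZMod p) → Fin d → ZMod p := fun a j => ∑ l, a l * (v l j : ZMod p)
  have hwa : ∀ a, φ (wa a) = a := by
    intro a
    funext i
    rw [hφ]
    have e1 : ∀ l, ∑ j, ((Ψ i).coeff j : ZMod p) * (v l j : ZMod p) = if i = l then 1 else 0 := by
      intro l
      have := congrArg (fun z : ℤ => (z : ZMod p)) (hv i l)
      simp only [eval_eq_sum _ (h0 i)] at this
      push_cast at this
      rw [this]
    calc ∑ j, ((Ψ i).coeff j : ZMod p) * wa a j
        = ∑ j, ∑ l, a l * (((Ψ i).coeff j : ZMod p) * (v l j : ZMod p)) := by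
          refine sum_congr rfl fun j _ => ?_
          show ((Ψ i).coeff j : ZMod p) * ∑ l, a l * (v l j : ZMod p) = _
          rw [mul_sum]
          exact sum_congr rfl fun l _ => by ring
      _ = ∑ l, a l * ∑ j, ((Ψ i).coeff j : ZMod p) * (v l j : ZMod p) := by
          rw [sum_comm]
          exact sum_congr rfl fun l _ => by rw [mul_sum]
      _ = a i := by
          simp only [e1, mul_ite, mul_one, mul_zero]
          rw [sum_ite_eq]
          simp
  -- all fibres have the cardinality of the kernel
  set F : ℕ := #{w : Fin d → ZMod p | φ w = 0} with hFdef
  have hfib : ∀ a, #{w : Fin d → ZMod p | φ w = a} = F := by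
    intro a
    refine card_nbij' (fun w => w - wa a) (fun w => w + wa a) (fun w hw => ?_) (fun w hw => ?_)
      (fun w _ => by simp) (fun w _ => by simp)
    · simp only [mem_coe, mem_filter, mem_univ, true_and] at hw ⊢
      rw [map_sub, hw, hwa, sub_self]
    · simp only [mem_coe, mem_filter, mem_univ, true_and] at hw ⊢
      rw [map_add, hw, hwa, zero_add]
  -- `p^t F = p^d`
  have htot : p ^ t * F = p ^ d := by
    have h1 := card_eq_sum_card_fiberwise (f := φ) (s := (univ : Finset (Fin d → ZMod p)))
      (t := univ) (fun _ _ => mem_coe.2 (mem_univ _))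
    simp only [hfib, sum_const, smul_eq_mul, card_univ, Fintype.card_fun, ZMod.card,
      Fintype.card_fin] at h1
    simpa [filter_true_of_mem] using h1.symm
  -- the good points are the fibres over `T = {a : all aᵢ ≠ 0}`
  set T : Finset (Fin t → ZMod p) := Fintype.piFinset fun _ => univ.erase 0 with hTdef
  have hTcard : #T = (p - 1) ^ t := by
    rw [hTdef, Fintype.card_piFinset, prod_const, card_erase_of_mem (mem_univ _), card_univ,
      ZMod.card, card_univ, Fintype.card_fin]
  have hgoodZ : #{w : Fin d → ZMod p | ∀ i, φ w i ≠ 0} = (p - 1) ^ t * F := by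
    have h1 := card_eq_sum_card_fiberwise (f := φ)
      (s := ({w : Fin d → ZMod p | ∀ i, φ w i ≠ 0} : Finset _)) (t := T) (fun w hw => by
        simp only [coe_filter, mem_univ, true_and, Set.mem_setOf_eq] at hw
        simp only [hTdef, Fintype.coe_piFinset, Set.mem_pi, Set.mem_univ, coe_erase, coe_univ,
          Set.mem_sdiff, Set.mem_singleton_iff, true_and, forall_const]
        exact hw)
    rw [h1, ← hTcard, ← smul_eq_mul, ← sum_const]
    refine sum_congr rfl fun a ha => ?_
    rw [← hfib a]
    congr 1
    ext w
    simp only [mem_filter, mem_univ, true_and, and_iff_right_iff_imp]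
    intro hw i
    rw [hw]
    have := Fintype.mem_piFinset.1 ha i
    exact (mem_erase.1 this).1
  -- transfer to `{0,…,p-1}^d`
  have hgood : #{n ∈ Fintype.piFinset (fun _ : Fin d => range p) |
      ∀ i, ¬ (p : ℤ) ∣ (Ψ i).eval fun j => (n j : ℤ)} = #{w : Fin d → ZMod p | ∀ i, φ w i ≠ 0} := by
    refine card_nbij' (fun n j => (n j : ZMod p)) (fun w j => (w j).val) (fun n hn => ?_)
      (fun w hw => ?_) (fun n hn => ?_) (fun w _ => ?_)
    · simp only [mem_coe, mem_filter, mem_univ, true_and] at hn ⊢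
      intro i
      have h2 := hn.2 i
      rw [← ZMod.intCast_zmod_eq_zero_iff_dvd, hcast] at h2
      simpa only [Int.cast_natCast] using h2
    · simp only [mem_coe, mem_filter, mem_univ, true_and, Fintype.mem_piFinset, mem_range] at hw ⊢
      refine ⟨fun j => ZMod.val_lt (w j), fun i => ?_⟩
      rw [← ZMod.intCast_zmod_eq_zero_iff_dvd, hcast]
      simpa only [Int.cast_natCast, ZMod.natCast_zmod_val] using hw i
    · simp only [mem_coe, mem_filter, Fintype.mem_piFinset, mem_range] at hn
      funext j
      exact ZMod.val_natCast_of_lt (hn.1 j)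
    · funext j
      exact ZMod.natCast_zmod_val (w j)
  rw [hgood, hgoodZ, mul_assoc, mul_comm F, htot]

/-- **`β_p = 1` for a system with a dual frame** (every prime `p`):
`β_p = p^{-d} (p/(p-1))^t #{n : p ∤ ψ₁(n) ⋯ ψ_t(n)} = p^{-d} (p/(p-1))^t (p-1)^t p^{d-t} = 1`.
[cite: PandeyWoo2024, Theorem 3 (definition of `β_p`)] -/
theorem localFactor_eq_one_of_frame {p : ℕ} (hp : p.Prime) (Ψ : Fin t → AffLinForm d)
    (h0 : ∀ i, (Ψ i).const = 0) {v : Fin t → Fin d → ℤ} (hv : IsDualFrame Ψ v) :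
    localFactor Ψ p = 1 := by
  have hkey := card_good_mul_pow hp Ψ h0 hv
  set B := Fintype.piFinset (fun _ : Fin d => range p) with hB
  have hp1 : (1 : ℝ) < p := by exact_mod_cast hp.one_lt
  have hp0 : (0 : ℝ) < p := by linarith
  have hkeyR : ((#{n ∈ B | ∀ i, ¬ (p : ℤ) ∣ (Ψ i).eval fun j => (n j : ℤ)} : ℕ) : ℝ) * (p : ℝ) ^ t =
      ((p : ℝ) - 1) ^ t * (p : ℝ) ^ d := by
    have := congrArg (fun k : ℕ => (k : ℝ)) hkey
    push_cast [Nat.cast_sub hp.one_le] at this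
    exact this
  set c : ℝ := (p : ℝ) / ((p : ℝ) - 1) with hc
  have hterm : ∀ n ∈ B, ∏ i, localVonMangoldt p ((Ψ i).eval fun j => (n j : ℤ)) =
      if ∀ i, ¬ (p : ℤ) ∣ (Ψ i).eval fun j => (n j : ℤ) then c ^ t else 0 := by
    intro n _
    simp only [localVonMangoldt_prime hp]
    split_ifs with h
    · rw [prod_congr rfl fun i _ => if_neg (h i), prod_const, card_univ, Fintype.card_fin]
    · push Not at h
      obtain ⟨i, hi⟩ := h
      exact prod_eq_zero (mem_univ i) (if_pos hi)
  unfold localFactor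
  rw [sum_congr rfl hterm, sum_ite, sum_const_zero, add_zero, sum_const, nsmul_eq_mul]
  have hp1' : (p : ℝ) - 1 ≠ 0 := by linarith
  have hct : c ^ t = (p : ℝ) ^ t / ((p : ℝ) - 1) ^ t := by rw [hc, div_pow]
  rw [hct]
  field_simp
  linear_combination hkeyR

/-- **`∏_p β_p = 1` for a system with a dual frame.**
[cite: PandeyWoo2024, Theorem 5 (main term)] -/
theorem singularProduct_eq_one_of_frame (Ψ : Fin t → AffLinForm d) (h0 : ∀ i, (Ψ i).const = 0)
    {v : Fin t → Fin d → ℤ} (hv : IsDualFrame Ψ v) : singularProduct Ψ = 1 := by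
  have hpart : singularProductPartial Ψ = fun _ => 1 := by
    funext x
    unfold singularProductPartial
    exact prod_eq_one fun p hp => localFactor_eq_one_of_frame (Nat.prime_of_mem_primesLE hp) Ψ h0 hv
  unfold singularProduct
  rw [hpart]
  exact tendsto_const_nhds.limUnder_eq

/-- The main term for a system with a dual frame: `H^d (log X)^{-t}`. [cite: PandeyWoo2024, Theorem 5] -/
theorem smallScaleMainTerm_of_frame (Ψ : Fin t → AffLinForm d) (h0 : ∀ i, (Ψ i).const = 0)
    {v : Fin t → Fin d → ℤ} (hv : IsDualFrame Ψ v) (lam : ℝ) (X : ℕ) :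
    smallScaleMainTerm Ψ lam X = (Real.log X ^ lam) ^ d / Real.log X ^ t := by
  unfold smallScaleMainTerm
  rw [singularProduct_eq_one_of_frame Ψ h0 hv, mul_one]


/-- The prime-pattern count over `∏ⱼ [zⱼ, zⱼ + H]` for an integer corner `z ≥ 0`, as a count over
`u ∈ {0, …, ⌊H⌋}^d`. [folklore] -/
theorem primePatternCount_eq_card (Ψ : Fin t → AffLinForm d) {z : Fin d → ℤ} (hz : ∀ j, 0 ≤ z j)
    (H : ℝ) :
    primePatternCount Ψ (fun j => (z j).toNat) H =
      #{u ∈ Fintype.piFinset (fun _ : Fin d => range (⌊H⌋₊ + 1)) |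
        ∀ i, ((Ψ i).eval (z + fun j => (u j : ℤ))).toNat.Prime} := by
  classical
  unfold primePatternCount shortBox
  rw [← card_box_filter_eq z ⌊H⌋₊ (fun n => ∀ i, ((Ψ i).eval n).toNat.Prime)]
  simp only [Int.toNat_of_nonneg (hz _)]

/-! ## Long windows: the prime number theorem -/

/-- `θ(m + h) − θ(m) = ∑_{m < p ≤ m+h} log p`. [folklore] -/
theorem theta_window_eq (m h : ℕ) :
    Chebyshev.theta ((m + h : ℕ) : ℝ) - Chebyshev.theta (m : ℝ) =
      ∑ p ∈ (Ioc m (m + h)).filter Nat.Prime, Real.log p := by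
  unfold Chebyshev.theta
  rw [Nat.floor_natCast, Nat.floor_natCast, ← Ioc_union_Ioc_eq_Ioc (Nat.zero_le m) (Nat.le_add_right m h),
    filter_union, sum_union]
  · ring
  · exact disjoint_left.2 fun x hx hx' => by
      simp only [mem_filter, mem_Ioc] at hx hx'
      omega

/-- The primes of `(m, m + h]` are the `m + k + 1`, `0 ≤ k < h`, that are prime. [folklore] -/
theorem card_Ioc_filter_prime (m h : ℕ) :
    #((Ioc m (m + h)).filter Nat.Prime) = #{k ∈ range h | (m + (k + 1)).Prime} := by
  refine card_nbij' (fun p => p - (m + 1)) (fun k => m + (k + 1)) (fun p hp => ?_) (fun k hk => ?_)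
    (fun p hp => ?_) (fun k _ => ?_)
  · simp only [mem_coe, mem_filter, mem_Ioc, mem_range] at hp ⊢
    refine ⟨by omega, ?_⟩
    convert hp.2 using 1
    omega
  · simp only [mem_coe, mem_filter, mem_Ioc, mem_range] at hk ⊢
    exact ⟨⟨by omega, by omega⟩, hk.2⟩
  · simp only [mem_coe, mem_filter, mem_Ioc] at hp
    dsimp only
    omega
  · dsimp only
    omega

/-- `R log(m + 1) ≤ θ(m + h) − θ(m)` for the number `R` of primes of `(m, m + h]`. [folklore] -/
theorem card_mul_log_le_theta_window (m h : ℕ) :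
    #{k ∈ range h | (m + (k + 1)).Prime} * Real.log ((m : ℝ) + 1) ≤
      Chebyshev.theta ((m + h : ℕ) : ℝ) - Chebyshev.theta (m : ℝ) := by
  rw [theta_window_eq, ← card_Ioc_filter_prime, ← nsmul_eq_mul]
  refine card_nsmul_le_sum _ _ _ fun p hp => ?_
  simp only [mem_filter, mem_Ioc] at hp
  have : ((m : ℝ) + 1) ≤ p := by exact_mod_cast hp.1.1
  exact Real.log_le_log (by positivity) this

/-- `θ(m + h) − θ(m) ≤ R log(m + h)` for the number `R` of primes of `(m, m + h]`. [folklore] -/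
theorem theta_window_le_card_mul_log (m h : ℕ) :
    Chebyshev.theta ((m + h : ℕ) : ℝ) - Chebyshev.theta (m : ℝ) ≤
      #{k ∈ range h | (m + (k + 1)).Prime} * Real.log ((m : ℝ) + h) := by
  rw [theta_window_eq, ← card_Ioc_filter_prime, ← nsmul_eq_mul]
  refine sum_le_card_nsmul _ _ _ fun p hp => ?_
  simp only [mem_filter, mem_Ioc] at hp
  have h1 : (p : ℝ) ≤ (m : ℝ) + h := by exact_mod_cast hp.1.2
  exact Real.log_le_log (by exact_mod_cast hp.2.pos) h1

/-- **The prime number theorem in long windows.** For `a > 0`, `C ≥ 1`, `ε > 0` and all large `N`: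
every window `(m, m + h]` with `aN ≤ m` and `m + h ≤ CN` has `|θ(m+h) − θ(m) − h| ≤ εN`
(from `θ(x) = x + o(x)`, the tree's `Literature.NumberTheory.LFunctions.chebyshevTheta_sub_self_isLittleO`).
[cite: MontgomeryVaughan2007, Thm. 6.9 (main term)] -/
theorem eventually_theta_window {a C ε : ℝ} (ha : 0 < a) (hC : 1 ≤ C) (hε : 0 < ε) :
    ∀ᶠ N : ℕ in atTop, ∀ m h : ℕ, a * N ≤ m → (m : ℝ) + h ≤ C * N →
      |Chebyshev.theta ((m + h : ℕ) : ℝ) - Chebyshev.theta (m : ℝ) - h| ≤ ε * N := by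
  have hε' : 0 < ε / (2 * C) := by positivity
  have h1 := (Literature.NumberTheory.LFunctions.chebyshevTheta_sub_self_isLittleO.def hε')
  obtain ⟨N₀, hN₀⟩ := eventually_atTop.1 h1
  filter_upwards [eventually_ge_atTop ⌈(N₀ : ℝ) / a⌉₊] with N hN m h hm hmh
  have hNa : (N₀ : ℝ) ≤ a * N := by
    have : (N₀ : ℝ) / a ≤ N := (Nat.le_ceil _).trans (by exact_mod_cast hN)
    rwa [div_le_iff₀' ha] at this
  have hm₀ : N₀ ≤ m := by
    have : (N₀ : ℝ) ≤ m := hNa.trans hm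
    exact_mod_cast this
  have hmh₀ : N₀ ≤ m + h := hm₀.trans (Nat.le_add_right m h)
  have e1 := hN₀ (m + h) hmh₀
  have e2 := hN₀ m hm₀
  simp only [Real.norm_eq_abs, Nat.abs_cast] at e1 e2
  have hm0 : (0 : ℝ) ≤ m := Nat.cast_nonneg m
  have hh0 : (0 : ℝ) ≤ h := Nat.cast_nonneg h
  have hmC : (m : ℝ) ≤ C * N := by linarith
  push_cast at e1 ⊢
  rw [abs_le] at e1 e2 ⊢
  have hb : ε / (2 * C) * ((m : ℝ) + h) + ε / (2 * C) * m ≤ ε * N := by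
    have hC0 : 0 < C := by linarith
    calc ε / (2 * C) * ((m : ℝ) + h) + ε / (2 * C) * m ≤ ε / (2 * C) * (C * N) + ε / (2 * C) * (C * N) := by
          gcongr
      _ = ε * N := by field_simp; ring
  constructor <;> linarith [e1.1, e1.2, e2.1, e2.2, hb]

/-! ## The final inequalities -/

/-- `(1 + ε)^n ≤ 1 + η/100` when `nε ≤ η/200 ≤ 1/200`. [folklore] -/
theorem one_add_pow_le {ε η : ℝ} {n : ℕ} (hε0 : 0 ≤ ε) (hη0 : 0 < η) (hη1 : η ≤ 1)
    (hn : (n : ℝ) * ε ≤ η / 200) : (1 + ε) ^ n ≤ 1 + η / 100 := by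
  have h1 : (1 + ε) ^ n ≤ Real.exp ((n : ℝ) * ε) := by
    rw [Real.exp_nat_mul]
    exact pow_le_pow_left₀ (by positivity) (by linarith [Real.add_one_le_exp ε]) n
  have h2 : Real.exp ((n : ℝ) * ε) ≤ Real.exp (η / 200) := Real.exp_le_exp.2 hn
  have h3 : Real.exp (η / 200) ≤ 1 + η / 200 + (η / 200) ^ 2 := by
    have := Real.abs_exp_sub_one_sub_id_le (x := η / 200) (by rw [abs_le]; constructor <;> linarith)
    rw [abs_le] at this
    linarith [this.2]
  nlinarith [h1, h2, h3]

/-- **Surplus, final inequality.** If the distinguished factor satisfies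
`(1 + η/8)/ℓ ≤ f_{i₀}`, the other `t − 1` factors `(1 − ε)/ℓ ≤ fᵢ` with `tε ≤ η/200`, and
`Hd1 ∏ᵢ fᵢ ≤ cnt` with `H^d ≤ Hd1`, then `cnt ≥ (1 + η/10) H^d/ℓ^t`. [folklore] -/
theorem frame_surplus_final {η ε ℓ Hd Hd1 cnt : ℝ} {f : Fin t → ℝ} (i₀ : Fin t)
    (hη0 : 0 < η) (hη1 : η ≤ 1) (hℓ : 0 < ℓ) (hHd : 0 ≤ Hd) (hHd1 : Hd ≤ Hd1)
    (hε0 : 0 ≤ ε) (hεt : (t : ℝ) * ε ≤ η / 200)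
    (hf₀ : (1 + η / 8) / ℓ ≤ f i₀) (hf : ∀ i, i ≠ i₀ → (1 - ε) / ℓ ≤ f i)
    (hcnt : Hd1 * ∏ i, f i ≤ cnt) :
    (1 + η / 10) * (Hd / ℓ ^ t) ≤ cnt := by
  have ht1 : 1 ≤ t := Nat.one_le_iff_ne_zero.2 fun h => by subst h; exact Fin.elim0 i₀
  have ht1R : (1 : ℝ) ≤ t := by exact_mod_cast ht1
  have hε1 : ε ≤ 1 / 200 := by nlinarith
  have hlow0 : 0 ≤ (1 - ε) / ℓ := div_nonneg (by linarith) hℓ.le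
  -- the other factors
  have hrest : ((1 - ε) / ℓ) ^ (t - 1) ≤ ∏ i ∈ univ.erase i₀, f i := by
    have h1 : ∏ _i ∈ univ.erase i₀, (1 - ε) / ℓ ≤ ∏ i ∈ univ.erase i₀, f i :=
      prod_le_prod (fun i _ => hlow0) fun i hi => hf i (ne_of_mem_erase hi)
    rwa [prod_const, card_erase_of_mem (mem_univ _), card_univ, Fintype.card_fin] at h1
  have hbern : 1 - η / 200 ≤ (1 - ε) ^ (t - 1) := by
    have h1 := one_add_mul_le_pow (a := -ε) (by linarith) (t - 1)
    have h2 : ((t - 1 : ℕ) : ℝ) * ε ≤ η / 200 := by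
      have : ((t - 1 : ℕ) : ℝ) ≤ t := by exact_mod_cast Nat.sub_le t 1
      nlinarith
    have h3 : (1 + -ε) = (1 - ε) := by ring
    rw [h3] at h1
    nlinarith [h1, h2]
  have hprod : (1 + η / 8) / ℓ * (((1 - ε) / ℓ) ^ (t - 1)) ≤ ∏ i, f i := by
    rw [← mul_prod_erase univ f (mem_univ i₀)]
    exact mul_le_mul hf₀ hrest (pow_nonneg hlow0 _) (le_trans (by positivity) hf₀)
  have hℓt : ℓ ^ t = ℓ * ℓ ^ (t - 1) := by
    rw [← pow_succ', Nat.sub_add_cancel ht1]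
  have hkey : (1 + η / 10) / ℓ ^ t ≤ ∏ i, f i := by
    refine le_trans ?_ hprod
    rw [div_pow, div_mul_div_comm, ← hℓt, div_le_div_iff_of_pos_right (by positivity)]
    have h14 : 0 ≤ 1 + η / 8 := by positivity
    calc 1 + η / 10 ≤ (1 + η / 8) * (1 - η / 200) := by nlinarith
      _ ≤ (1 + η / 8) * (1 - ε) ^ (t - 1) := mul_le_mul_of_nonneg_left hbern h14
  have hprod0 : 0 ≤ ∏ i, f i := le_trans (by positivity) hkey
  calc (1 + η / 10) * (Hd / ℓ ^ t) = Hd * ((1 + η / 10) / ℓ ^ t) := by ring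
    _ ≤ Hd1 * ∏ i, f i := mul_le_mul hHd1 hkey (by positivity) (hHd.trans hHd1)
    _ ≤ cnt := hcnt

/-- **Deficit, final inequality.** If the distinguished factor satisfies
`g_{i₀} ≤ (1 − η/16)/ℓ`, the other factors `0 ≤ gᵢ ≤ (1 + ε)/ℓ` with `tε ≤ η/200`, the lattice
count `HdP ≤ (1 + η/200) H^d`, and `cnt ≤ HdP ∏ᵢ gᵢ`, then `cnt ≤ (1 − η/25) H^d/ℓ^t`.
[folklore] -/
theorem frame_deficit_final {η ε ℓ Hd HdP cnt : ℝ} {g : Fin t → ℝ} (i₀ : Fin t)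
    (hη0 : 0 < η) (hη1 : η ≤ 1) (hℓ : 0 < ℓ) (hHd : 0 ≤ Hd)
    (hHdP : HdP ≤ (1 + η / 200) * Hd) (hε0 : 0 ≤ ε) (hεt : (t : ℝ) * ε ≤ η / 200)
    (hg0 : ∀ i, 0 ≤ g i) (hg₀ : g i₀ ≤ (1 - η / 16) / ℓ) (hg : ∀ i, i ≠ i₀ → g i ≤ (1 + ε) / ℓ)
    (hcnt : cnt ≤ HdP * ∏ i, g i) :
    cnt ≤ (1 - η / 25) * (Hd / ℓ ^ t) := by
  have ht1 : 1 ≤ t := Nat.one_le_iff_ne_zero.2 fun h => by subst h; exact Fin.elim0 i₀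
  -- the other factors
  have hrest : ∏ i ∈ univ.erase i₀, g i ≤ ((1 + ε) / ℓ) ^ (t - 1) := by
    have h1 : ∏ i ∈ univ.erase i₀, g i ≤ ∏ _i ∈ univ.erase i₀, (1 + ε) / ℓ :=
      prod_le_prod (fun i _ => hg0 i) fun i hi => hg i (ne_of_mem_erase hi)
    rwa [prod_const, card_erase_of_mem (mem_univ _), card_univ, Fintype.card_fin] at h1
  have hexp : (1 + ε) ^ (t - 1) ≤ 1 + η / 100 := by
    refine one_add_pow_le hε0 hη0 hη1 (le_trans ?_ hεt)
    have : ((t - 1 : ℕ) : ℝ) ≤ t := by exact_mod_cast Nat.sub_le t 1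
    nlinarith
  have hrest0 : 0 ≤ ∏ i ∈ univ.erase i₀, g i := prod_nonneg fun i _ => hg0 i
  have hprod : ∏ i, g i ≤ (1 - η / 16) / ℓ * ((1 + ε) / ℓ) ^ (t - 1) := by
    rw [← mul_prod_erase univ g (mem_univ i₀)]
    exact mul_le_mul hg₀ hrest hrest0 (by
      have : 0 ≤ 1 - η / 16 := by linarith
      positivity)
  have hℓt : ℓ ^ t = ℓ * ℓ ^ (t - 1) := by
    rw [← pow_succ', Nat.sub_add_cancel ht1]
  have hkey : ∏ i, g i ≤ (1 - η / 16) * (1 + η / 100) / ℓ ^ t := by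
    refine hprod.trans ?_
    rw [div_pow, div_mul_div_comm, ← hℓt, div_le_div_iff_of_pos_right (by positivity)]
    have h14 : 0 ≤ 1 - η / 16 := by linarith
    exact mul_le_mul_of_nonneg_left hexp h14
  have hprod0 : 0 ≤ ∏ i, g i := prod_nonneg fun i _ => hg0 i
  calc cnt ≤ HdP * ∏ i, g i := hcnt
    _ ≤ ((1 + η / 200) * Hd) * ((1 - η / 16) * (1 + η / 100) / ℓ ^ t) :=
        mul_le_mul hHdP hkey hprod0 (by positivity)
    _ = Hd / ℓ ^ t * ((1 - η / 16) * ((1 + η / 200) * (1 + η / 100))) := by ring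
    _ ≤ Hd / ℓ ^ t * (1 - η / 25) := by
        refine mul_le_mul_of_nonneg_left ?_ (by positivity)
        have hsq : η * η ≤ η := by nlinarith
        have h1 : (1 + η / 200) * (1 + η / 100) ≤ 1 + η / 50 := by nlinarith
        have h2 : (1 - η / 16) * (1 + η / 50) ≤ 1 - η / 25 := by nlinarith
        have h14 : 0 ≤ 1 - η / 16 := by linarith
        exact (mul_le_mul_of_nonneg_left h1 h14).trans h2
    _ = (1 - η / 25) * (Hd / ℓ ^ t) := by ring


/-- **A long window, from below.** If `R · Lup ≥ θd ≥ hL − E` (the window `(m, m+hL]` holds `R`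
primes, each `≤ e^{Lup}`, and `θ` grows by at least `hL − E` over it), `Lup ≤ ℓ + Lc`,
`E ≤ (ε/4) hL`, the shift `C` satisfies `C ℓ ≤ (ε/4) hL`, and `4 Lc ≤ ε ℓ`, then
`(R − C)/hL ≥ (1 − ε)/ℓ`. [folklore] -/
theorem long_factor_lower {R hL C ℓ Lc Lup θd E ε : ℝ} (hℓ : 0 < ℓ) (hhL : 0 < hL)
    (hε : 0 < ε) (hε1 : ε ≤ 1) (hLc : 0 ≤ Lc) (hLup : 0 < Lup) (hlogup : Lup ≤ ℓ + Lc)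
    (hθ : hL - E ≤ θd) (hRθ : θd ≤ R * Lup) (hE : E ≤ ε / 4 * hL) (hC : C * ℓ ≤ ε / 4 * hL)
    (hℓbig : 4 * Lc ≤ ε * ℓ) :
    (1 - ε) / ℓ ≤ (R - C) / hL := by
  -- `R ≥ (1 - ε/4) hL / Lup`
  have h1 : (1 - ε / 4) * hL ≤ R * Lup := by linarith
  have hR : (1 - ε / 4) * hL / Lup ≤ R := by rw [div_le_iff₀ hLup]; exact h1
  -- `(1 - ε/4)/Lup ≥ (1 - ε/2)/ℓ`
  have h2 : (1 - ε / 2) / ℓ ≤ (1 - ε / 4) / Lup := by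
    rw [div_le_div_iff₀ hℓ hLup]
    have : (1 - ε / 2) * Lup ≤ (1 - ε / 2) * (ℓ + Lc) :=
      mul_le_mul_of_nonneg_left hlogup (by linarith)
    nlinarith
  have h3 : (1 - ε / 2) / ℓ * hL ≤ R := by
    calc (1 - ε / 2) / ℓ * hL ≤ (1 - ε / 4) / Lup * hL := mul_le_mul_of_nonneg_right h2 hhL.le
      _ = (1 - ε / 4) * hL / Lup := by ring
      _ ≤ R := hR
  have h4 : C ≤ ε / 4 / ℓ * hL := by
    rw [div_mul_eq_mul_div, le_div_iff₀ hℓ]; linarith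
  rw [div_le_div_iff₀ hℓ hhL]
  have h5 : ((1 - ε / 2) / ℓ - ε / 4 / ℓ) * hL ≤ R - C := by linarith
  have h6 : (1 - ε) / ℓ ≤ (1 - ε / 2) / ℓ - ε / 4 / ℓ := by
    rw [← sub_div, div_le_div_iff_of_pos_right hℓ]; linarith
  calc (1 - ε) * hL = (1 - ε) / ℓ * hL * ℓ := by field_simp
    _ ≤ ((1 - ε / 2) / ℓ - ε / 4 / ℓ) * hL * ℓ := by gcongr
    _ ≤ (R - C) * ℓ := mul_le_mul_of_nonneg_right h5 hℓ.le

/-- **A long window, from above.** If `R · Llow ≤ θd ≤ hL + E` (the `R` primes of the window are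
each `≥ e^{Llow}`), `ℓ ≤ Llow`, `E ≤ (ε/4) hL`, `0 ≤ C` with `C ℓ ≤ (ε/4) hL` and `0 ≤ R`, then
`(R + C)/hL ≤ (1 + ε)/ℓ`. [folklore] -/
theorem long_factor_upper {R hL C ℓ Llow θd E ε : ℝ} (hℓ : 0 < ℓ) (hhL : 0 < hL) (hε : 0 ≤ ε)
    (hlow : ℓ ≤ Llow) (hθ : θd ≤ hL + E) (hRθ : R * Llow ≤ θd) (hR0 : 0 ≤ R)
    (hE : E ≤ ε / 4 * hL) (hC : C * ℓ ≤ ε / 4 * hL) :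
    (R + C) / hL ≤ (1 + ε) / ℓ := by
  have h1 : R * ℓ ≤ (1 + ε / 4) * hL := by
    have : R * ℓ ≤ R * Llow := mul_le_mul_of_nonneg_left hlow hR0
    linarith
  rw [div_le_div_iff₀ hhL hℓ]
  nlinarith [mul_nonneg hε hhL.le]

end Frame

end Literature.Barriers.Parity
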